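import Summits.AtomisticToContinuum.HydrodynamicLimit.Theorems.AnnealedZeroHorizonMeanFluxClosureCollisionalStressClosureC
import Summits.AtomisticToContinuum.HydrodynamicLimit.Theorems.AnnealedZeroHorizonMeanFluxClosureCollisionEnergyExchangeMeanBound
import HarnessLib

/-!
# Stub CS `stub_collisionalStressClosure` of crux `MeanFluxClosure`
# (stmt-AtomisticToContinuum-9256, route AnnealedZeroHorizon, line `registered`): EOS-free part D,
# composition with the landed FLUX integrability — unconditional statements

Parts A–C are conditional on the integrability of the relative-speed collision functional `RS ∘ Φ_{t₁}`;
the FLUX support file (`…CollisionEnergyExchangeMeanBound`, `integrable_relSpeedFunctional_flow`,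
`relSpeedFunctional_flow_const`) supplies it under the local Gibbs law at EVERY `N` (continuous positive
profiles, `0 < σ ≤ 1/2`), with the mean bound `σ_N c ∫ RS ≤ 80 σ³ (3θ + ‖u‖²)(t₂ − t₁)` at constant profiles.
Composing:

* `integrable_avg_momentumTransfer_flow`, `integrable_avg_contactRemainder_flow`,
  `integrable_avg_collisionalStress_flow` — under `localGibbsLaw σ a₀ u₀ θ₀ N Φ` (continuous `a₀, θ₀ > 0`,
  `u₀`; `0 < σ < 1/2`; every `N`, every flow, `0 ≤ t₁ ≤ t₂`) the stub's collisional term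
  `c W_φ ∘ Φ_{t₁}`, its Taylor remainder `c (W_φ − collisionalStress (Dφ)) ∘ Φ_{t₁}` and every collisional
  stress `c · collisionalStress A ∘ Φ_{t₁}` (continuous `A`) are INTEGRABLE — the `Integrable` half of stub CS
  for its first summand, unconditionally.
* `integral_abs_avg_momentumTransfer_le_const`, `integral_abs_avg_contactRemainder_le_const` — at constant
  profiles `E |c W_φ ∘ Φ_{t₁}| ≤ 40 L σ³ (3θ + ‖u‖²)(t₂ − t₁)` (bounded uniformly in `N`: the collisional
  momentum transfer per particle is `O(σ³)`) and
  `E |c (W_φ − collisionalStress (Dφ)) ∘ Φ_{t₁}| ≤ 20 M σ³ (3θ + ‖u‖²)(t₂ − t₁) · σ_N → 0`.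
* `stub_collisionalStressContactRemainderConst` — registered sub-goal of stmt-AtomisticToContinuum-9256: at
  constant profiles, in the crux's format (`∀ᶠ N`, `∀ D, D = … → Integrable D ∧ |∫ D| ≤ ε`), the collisional
  momentum transfer equals the collision-indexed stress of `Dφ` IN MEAN — the contact-remainder closure,
  unconditional in equilibrium (rate `σ_N = σ (N+1)^{-1/3}`).

References: H. Spohn, *Large Scale Dynamics of Interacting Particles* (1991), Part I §3.2 (3.7), (3.15).
-/

noncomputable section

namespace Summit.AtomisticToContinuum.HydrodynamicLimit.Theorems

open scoped BigOperators ENNReal Topology InnerProductSpace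
open MeasureTheory Set Filter Function
open Literature.MathematicalPhysics.KineticTheory Literature.Analysis.FluidPDE Literature.Analysis.FunctionSpaces
open Summit.AtomisticToContinuum.HydrodynamicLimit.Theorems.CollisionEnergyExchangeMeanBound

namespace CollisionalStressClosure

/-! ## General profiles: integrability at every `N` -/

section General

variable {a₀ θ₀ : T3 → ℝ} {u₀ : T3 → V3} {σ : ℝ} {N : ℕ}
  (Φ : HardSphereFlow (Torus.geometry (Fin 3)) (hsDiameter σ N) (N + 1))

/-- **Integrability of the stub's collisional term** `c W_φ ∘ Φ_{t₁}` under the local Gibbs law, every `N`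
(continuous `a₀, θ₀ > 0`, `u₀`; `0 < σ ≤ 1/2`; `φ ∈ C¹`; `0 ≤ t₁ ≤ t₂`), with
`∫ |c W_φ ∘ Φ_{t₁}| ≤ L σ_N c ½ ∫ RS ∘ Φ_{t₁}` for `‖Dφ‖ ≤ L`. [folklore] -/
theorem integrable_avg_momentumTransfer_flow (ha : Continuous a₀) (hθ : Continuous θ₀) (hu : Continuous u₀)
    (ha0 : ∀ x, 0 < a₀ x) (hθ0 : ∀ x, 0 < θ₀ x) (hσ : 0 < σ) (hσ2 : σ ≤ 1 / 2) {φ : T3 → V3}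
    (hφ : Torus.IsContDiff 1 φ) {L : ℝ} (hL : ∀ x, ‖Torus.fderiv φ x‖ ≤ L) {t₁ t₂ : ℝ} (h₁ : 0 ≤ t₁)
    (h₁₂ : t₁ ≤ t₂) :
    Integrable (fun z => ((N + 1 : ℕ) : ℝ)⁻¹ * Φ.momentumTransfer φ (Φ.flow t₁ z) (t₂ - t₁))
        (localGibbsLaw σ a₀ u₀ θ₀ N Φ) ∧
      ∫ z, |((N + 1 : ℕ) : ℝ)⁻¹ * Φ.momentumTransfer φ (Φ.flow t₁ z) (t₂ - t₁)| ∂localGibbsLaw σ a₀ u₀ θ₀ N Φ ≤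
        L * hsDiameter σ N * ((N + 1 : ℕ) : ℝ)⁻¹ * (2⁻¹ * ∫ z, Φ.collisionalTransferFunctional
          (fun (i j : Fin (N + 1)) (pre _post : Config (N + 1) (Fin 3) T3) => ‖(pre i).2 - (pre j).2‖)
          (Φ.flow t₁ z) (t₂ - t₁) ∂localGibbsLaw σ a₀ u₀ θ₀ N Φ) :=
  integrable_avg_momentumTransfer_flow_localGibbsLaw a₀ θ₀ u₀ N Φ hσ.le hφ hL h₁ h₁₂
    (integrable_relSpeedFunctional_flow ha hθ hu ha0 hθ0 hσ hσ2 Φ h₁ h₁₂)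

/-- **Integrability of the Taylor (contact) remainder** `c (W_φ − collisionalStress (Dφ)) ∘ Φ_{t₁}` under the
local Gibbs law, every `N` (`0 < σ < 1/2`, `φ ∈ C¹`, `Dφ ∈ C¹`, `‖D²φ‖ ≤ M`), with
`∫ |·| ≤ ½ M σ_N² c ½ ∫ RS ∘ Φ_{t₁}`. [folklore] -/
theorem integrable_avg_contactRemainder_flow (ha : Continuous a₀) (hθ : Continuous θ₀) (hu : Continuous u₀)
    (ha0 : ∀ x, 0 < a₀ x) (hθ0 : ∀ x, 0 < θ₀ x) (hσ : 0 < σ) (hσ₂ : σ < 2⁻¹) {φ : T3 → V3}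
    (hφ : Torus.IsContDiff 1 φ) (hDφ : Torus.IsContDiff 1 (Torus.fderiv φ)) {M : ℝ}
    (hM : ∀ x, ‖Torus.fderiv (Torus.fderiv φ) x‖ ≤ M) {t₁ t₂ : ℝ} (h₁ : 0 ≤ t₁) (h₁₂ : t₁ ≤ t₂) :
    Integrable (fun z => ((N + 1 : ℕ) : ℝ)⁻¹ * (Φ.momentumTransfer φ (Φ.flow t₁ z) (t₂ - t₁) -
        Φ.collisionalStress (Torus.fderiv φ) (Φ.flow t₁ z) (t₂ - t₁))) (localGibbsLaw σ a₀ u₀ θ₀ N Φ) ∧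
      ∫ z, |((N + 1 : ℕ) : ℝ)⁻¹ * (Φ.momentumTransfer φ (Φ.flow t₁ z) (t₂ - t₁) -
          Φ.collisionalStress (Torus.fderiv φ) (Φ.flow t₁ z) (t₂ - t₁))| ∂localGibbsLaw σ a₀ u₀ θ₀ N Φ ≤
        2⁻¹ * M * hsDiameter σ N ^ 2 * ((N + 1 : ℕ) : ℝ)⁻¹ * (2⁻¹ * ∫ z, Φ.collisionalTransferFunctional
          (fun (i j : Fin (N + 1)) (pre _post : Config (N + 1) (Fin 3) T3) => ‖(pre i).2 - (pre j).2‖)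
          (Φ.flow t₁ z) (t₂ - t₁) ∂localGibbsLaw σ a₀ u₀ θ₀ N Φ) :=
  integrable_avg_momentumTransfer_sub_collisionalStress_flow_localGibbsLaw a₀ θ₀ u₀ N Φ hσ.le hσ₂ hφ hDφ hM
    h₁ h₁₂ (integrable_relSpeedFunctional_flow ha hθ hu ha0 hθ0 hσ (hσ₂.le.trans_eq (by norm_num)) Φ h₁ h₁₂)

/-- **Integrability of every collisional stress** `c · collisionalStress A ∘ Φ_{t₁}` under the local Gibbs
law, every `N` (`0 < σ < 1/2`, `A` continuous with `‖A x‖ ≤ C`), with `∫ |·| ≤ C σ_N c ½ ∫ RS ∘ Φ_{t₁}`. [folklore] -/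
theorem integrable_avg_collisionalStress_flow (ha : Continuous a₀) (hθ : Continuous θ₀) (hu : Continuous u₀)
    (ha0 : ∀ x, 0 < a₀ x) (hθ0 : ∀ x, 0 < θ₀ x) (hσ : 0 < σ) (hσ₂ : σ < 2⁻¹)
    {A : T3 → V3 →L[ℝ] V3} (hA : Continuous A) {C : ℝ} (hC : ∀ x, ‖A x‖ ≤ C) {t₁ t₂ : ℝ} (h₁ : 0 ≤ t₁)
    (h₁₂ : t₁ ≤ t₂) :
    Integrable (fun z => ((N + 1 : ℕ) : ℝ)⁻¹ * Φ.collisionalStress A (Φ.flow t₁ z) (t₂ - t₁))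
        (localGibbsLaw σ a₀ u₀ θ₀ N Φ) ∧
      ∫ z, |((N + 1 : ℕ) : ℝ)⁻¹ * Φ.collisionalStress A (Φ.flow t₁ z) (t₂ - t₁)| ∂localGibbsLaw σ a₀ u₀ θ₀ N Φ ≤
        C * hsDiameter σ N * ((N + 1 : ℕ) : ℝ)⁻¹ * (2⁻¹ * ∫ z, Φ.collisionalTransferFunctional
          (fun (i j : Fin (N + 1)) (pre _post : Config (N + 1) (Fin 3) T3) => ‖(pre i).2 - (pre j).2‖)
          (Φ.flow t₁ z) (t₂ - t₁) ∂localGibbsLaw σ a₀ u₀ θ₀ N Φ) := by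
  have hε : hsDiameter σ N < 2⁻¹ := (hsDiameter_le hσ.le N).trans_lt hσ₂
  obtain ⟨hint, hle⟩ := integrable_collisionalStress_flow_of_integrable_relSpeed Φ (hsDiameter_pos hσ N).le hε
    hA hC h₁ h₁₂ (localGibbsLaw_absolutelyContinuous σ a₀ u₀ θ₀ N Φ)
    (integrable_relSpeedFunctional_flow ha hθ hu ha0 hθ0 hσ (hσ₂.le.trans_eq (by norm_num)) Φ h₁ h₁₂)
  have hc : 0 ≤ ((N + 1 : ℕ) : ℝ)⁻¹ := inv_nonneg.2 (Nat.cast_nonneg _)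
  refine ⟨hint.const_mul _, ?_⟩
  simp only [abs_mul, abs_of_nonneg hc]
  rw [integral_const_mul]
  exact (mul_le_mul_of_nonneg_left hle hc).trans_eq (by ring)

end General

/-! ## Constant profiles: explicit mean bounds, uniformly in `N` -/

section Const

variable {σ : ℝ} {N : ℕ} (Φ : HardSphereFlow (Torus.geometry (Fin 3)) (hsDiameter σ N) (N + 1))

/-- **Mean size of the collisional momentum transfer per particle in equilibrium**: at constant profiles
`a, θ > 0`, `u`, for `0 < σ ≤ 1/2`, every `N`, `φ ∈ C¹` with `‖Dφ‖ ≤ L`, `0 ≤ t₁ ≤ t₂`: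
`E |c W_φ ∘ Φ_{t₁}| ≤ 40 L σ³ (3θ + ‖u‖²)(t₂ − t₁)` (`mmr_collisionFlux_const` through FLUX). [folklore] -/
theorem integral_abs_avg_momentumTransfer_le_const (hσ : 0 < σ) (hσ2 : σ ≤ 1 / 2) {a θ : ℝ} (u : V3)
    (ha : 0 < a) (hθ : 0 < θ) {φ : T3 → V3} (hφ : Torus.IsContDiff 1 φ) {L : ℝ}
    (hL : ∀ x, ‖Torus.fderiv φ x‖ ≤ L) {t₁ t₂ : ℝ} (h₁ : 0 ≤ t₁) (h₁₂ : t₁ ≤ t₂) :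
    ∫ z, |((N + 1 : ℕ) : ℝ)⁻¹ * Φ.momentumTransfer φ (Φ.flow t₁ z) (t₂ - t₁)|
        ∂localGibbsLaw σ (fun _ => a) (fun _ => u) (fun _ => θ) N Φ ≤
      40 * L * σ ^ 3 * (3 * θ + ‖u‖ ^ 2) * (t₂ - t₁) := by
  have hL0 : 0 ≤ L := (norm_nonneg _).trans (hL 0)
  obtain ⟨hRS, hmean⟩ := relSpeedFunctional_flow_const hσ hσ2 u ha hθ Φ h₁ h₁₂
  obtain ⟨-, hle⟩ := integrable_avg_momentumTransfer_flow_localGibbsLaw (fun _ => a) (fun _ => θ) (fun _ => u)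
    N Φ hσ.le hφ hL h₁ h₁₂ hRS
  refine hle.trans ?_
  have key := mul_le_mul_of_nonneg_left hmean (mul_nonneg hL0 (by norm_num : (0 : ℝ) ≤ 2⁻¹))
  refine le_trans (le_of_eq ?_) (key.trans_eq (by ring))
  ring

/-- **The contact remainder vanishes in mean in equilibrium, with rate `σ_N`**: at constant profiles, for
`0 < σ < 1/2`, every `N`, `φ ∈ C¹`, `Dφ ∈ C¹` with `‖D²φ‖ ≤ M`, `0 ≤ t₁ ≤ t₂`:
`E |c (W_φ − collisionalStress (Dφ)) ∘ Φ_{t₁}| ≤ 20 M σ³ (3θ + ‖u‖²)(t₂ − t₁) · σ_N`. [folklore] -/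
theorem integral_abs_avg_contactRemainder_le_const (hσ : 0 < σ) (hσ₂ : σ < 2⁻¹) {a θ : ℝ} (u : V3)
    (ha : 0 < a) (hθ : 0 < θ) {φ : T3 → V3} (hφ : Torus.IsContDiff 1 φ)
    (hDφ : Torus.IsContDiff 1 (Torus.fderiv φ)) {M : ℝ} (hM : ∀ x, ‖Torus.fderiv (Torus.fderiv φ) x‖ ≤ M)
    {t₁ t₂ : ℝ} (h₁ : 0 ≤ t₁) (h₁₂ : t₁ ≤ t₂) :
    ∫ z, |((N + 1 : ℕ) : ℝ)⁻¹ * (Φ.momentumTransfer φ (Φ.flow t₁ z) (t₂ - t₁) -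
        Φ.collisionalStress (Torus.fderiv φ) (Φ.flow t₁ z) (t₂ - t₁))|
        ∂localGibbsLaw σ (fun _ => a) (fun _ => u) (fun _ => θ) N Φ ≤
      20 * M * σ ^ 3 * (3 * θ + ‖u‖ ^ 2) * (t₂ - t₁) * hsDiameter σ N := by
  have hM0 : 0 ≤ M := (norm_nonneg _).trans (hM 0)
  have hε0 : 0 ≤ hsDiameter σ N := (hsDiameter_pos hσ N).le
  obtain ⟨hRS, hmean⟩ := relSpeedFunctional_flow_const hσ (hσ₂.le.trans_eq (by norm_num)) u ha hθ Φ h₁ h₁₂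
  obtain ⟨-, hle⟩ := integrable_avg_momentumTransfer_sub_collisionalStress_flow_localGibbsLaw (fun _ => a)
    (fun _ => θ) (fun _ => u) N Φ hσ.le hσ₂ hφ hDφ hM h₁ h₁₂ hRS
  refine hle.trans ?_
  have key := mul_le_mul_of_nonneg_left hmean
    (mul_nonneg (mul_nonneg (mul_nonneg (by norm_num : (0 : ℝ) ≤ 2⁻¹) hM0) hε0) (by norm_num : (0 : ℝ) ≤ 2⁻¹))
  refine le_trans (le_of_eq ?_) (key.trans_eq (by ring))
  ring

end Const

end CollisionalStressClosure

open CollisionalStressClosure in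
/-- **Registered sub-goal `stub_collisionalStressContactRemainderConst` of stmt-AtomisticToContinuum-9256
(stub CS at CONSTANT profiles, contact-remainder part; EOS-free, unconditional).** In equilibrium
(`a, θ > 0`, `u`; `0 < σ < 1/2`; any flow family, `0 ≤ t₁ ≤ t₂`, smooth `φ`), in the crux's format: eventually
in `N` the functional `z ↦ c (W_φ − collisionalStress (Dφ))(Φ_{t₁} z, t₂ − t₁)` is integrable under the Gibbs
law with `|mean| ≤ ε` — the stub's collisional momentum transfer may be replaced by the collision-indexed
stress of `Dφ` in mean (`E|·| ≤ 20 ‖D²φ‖_∞ σ³(3θ + ‖u‖²)(t₂ − t₁) σ_N`, `σ_N → 0`). [folklore] -/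
theorem stub_collisionalStressContactRemainderConst : ∀ (a θ : ℝ) (u : Literature.MathematicalPhysics.KineticTheory.V3), 0 < a → 0 < θ → ∀ (σ : ℝ), 0 < σ → σ < 1 / 2 → ∀ (Φ : (N : ℕ) → Literature.Analysis.FluidPDE.HardSphereFlow (Literature.Analysis.FluidPDE.Torus.geometry (Fin 3)) (Literature.MathematicalPhysics.KineticTheory.hsDiameter σ N) (N + 1)) (t₁ t₂ : ℝ), 0 ≤ t₁ → t₁ ≤ t₂ → ∀ (ε : ℝ), 0 < ε → ∀ (φ : Literature.MathematicalPhysics.KineticTheory.T3 → Literature.MathematicalPhysics.KineticTheory.V3), Literature.Analysis.FunctionSpaces.Torus.IsSmooth φ → ∀ᶠ N in Filter.atTop, ∀ D : Literature.Analysis.FluidPDE.Config (N + 1) (Fin 3) Literature.MathematicalPhysics.KineticTheory.T3 → ℝ, D = (fun z => ((N + 1 : ℕ) : ℝ)⁻¹ * ((Φ N).momentumTransfer φ ((Φ N).flow t₁ z) (t₂ - t₁) - (Φ N).collisionalStress (Literature.Analysis.FunctionSpaces.Torus.fderiv φ) ((Φ N).flow t₁ z) (t₂ - t₁))) → MeasureTheory.Integrable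 D (Literature.MathematicalPhysics.KineticTheory.localGibbsLaw σ (fun _ => a) (fun _ => u) (fun _ => θ) N (Φ N)) ∧ |∫ z, D z ∂Literature.MathematicalPhysics.KineticTheory.localGibbsLaw σ (fun _ => a) (fun _ => u) (fun _ => θ) N (Φ N)| ≤ ε := by
  intro a θ u ha hθ σ hσ hσ₂ Φ t₁ t₂ h₁ h₁₂ ε hε φ hφ
  obtain ⟨h1, h2, -, ⟨M, hM0, hM⟩⟩ := exists_bounds_of_isSmooth hφ
  have hσ₂' : σ < 2⁻¹ := by simpa only [one_div] using hσ₂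
  set K : ℝ := 20 * M * σ ^ 3 * (3 * θ + ‖u‖ ^ 2) * (t₂ - t₁) with hK
  have hK0 : 0 ≤ K := by
    have : 0 ≤ t₂ - t₁ := sub_nonneg.2 h₁₂
    positivity
  have hev : ∀ᶠ N : ℕ in atTop, K * hsDiameter σ N ≤ ε := by
    have ht : Tendsto (fun N : ℕ => K * hsDiameter σ N) atTop (𝓝 (K * 0)) :=
      (tendsto_hsDiameter σ).const_mul K
    rw [mul_zero] at ht
    exact (ht.eventually (Iic_mem_nhds hε)).mono fun N hN => hN
  filter_upwards [hev] with N hN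
  intro D hD
  subst hD
  obtain ⟨hint, -⟩ := integrable_avg_momentumTransfer_sub_collisionalStress_flow_localGibbsLaw (fun _ => a)
    (fun _ => θ) (fun _ => u) N (Φ N) hσ.le hσ₂' h1 h2 hM h₁ h₁₂
    (relSpeedFunctional_flow_const hσ hσ₂.le u ha hθ (Φ N) h₁ h₁₂).1
  refine ⟨hint, ?_⟩
  calc |∫ z, ((N + 1 : ℕ) : ℝ)⁻¹ * ((Φ N).momentumTransfer φ ((Φ N).flow t₁ z) (t₂ - t₁) -
          (Φ N).collisionalStress (Torus.fderiv φ) ((Φ N).flow t₁ z) (t₂ - t₁))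
          ∂localGibbsLaw σ (fun _ => a) (fun _ => u) (fun _ => θ) N (Φ N)|
      ≤ ∫ z, |((N + 1 : ℕ) : ℝ)⁻¹ * ((Φ N).momentumTransfer φ ((Φ N).flow t₁ z) (t₂ - t₁) -
          (Φ N).collisionalStress (Torus.fderiv φ) ((Φ N).flow t₁ z) (t₂ - t₁))|
          ∂localGibbsLaw σ (fun _ => a) (fun _ => u) (fun _ => θ) N (Φ N) := abs_integral_le_integral_abs
    _ ≤ K * hsDiameter σ N :=
        integral_abs_avg_contactRemainder_le_const (Φ N) hσ hσ₂' u ha hθ h1 h2 hM h₁ h₁₂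
    _ ≤ ε := hN

end Summit.AtomisticToContinuum.HydrodynamicLimit.Theorems
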